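/-
Copyright (c) 2026 the pub-hodgecm-mathlib formalisation cell (harness21).  Prover seat hodgecm-mathlib-K2Liu-p09 (g6): Track B «K2-LIT»,
hLiu418 = stmt-HodgeConjecture-24832; LEAD F0P6-plan RULING M-158d «A7-val road (σ)», file V8f (the `K′`-invariant witness of the (A4″-KR) assembly).
-/
import Summits.HodgeConjecture.HodgeConjecture.Theorems.K2LiuSWSectionKPrimeAverage   -- ★ (A4-avg): open stabilisers, finite orbits of `𝒮(F^ι)`, orbit averages
import HarnessLib

/-!
# Crux `HLiu418`, road `K2_Liu`, organ A7-val, file V8f: A `K′`-INVARIANT SCHWARTZ FUNCTION ON WHICH A FUNCTIONAL WITH NON-NEGATIVE ORBIT VALUES IS NON-ZERO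

Cell `hodgecm-mathlib`, crux item hLiu418 = `stmt-HodgeConjecture-24832`; squad K2 ∕ K2Liu; prover K2Liu-p09 (g6), organ lead A7-val.  THEOREMS ONLY; lane
`--supports stmt-HodgeConjecture-24832` (count-neutral helper).  GENERIC (any non-archimedean local field `F`, any compact `K′ ≤ G` acting linearly and
pointwise-continuously on `F^ι`): the binder `hBne` of ★ V8c∕V8e (`∃ Φ₁` `K′`-invariant with `B Φ₁ 1 ≠ 0`) from ONE test function `Φ` whose whole
`K′`-orbit has values of non-negative real part under the functional and whose own value has positive real part — at the instance `Φ = 𝟙_{box}`,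
`B Ψ 1 = (r_v Ψ)(0) = ∫ Ψ(θ_v⁻¹(0 ⊔ 0 ⊔ a)) dμ_v(a) ≥ 0` on indicators and `> 0` on the box itself (★ β-2 `krFun_indicator_pi`).
* `exists_invariant_apply_ne_zero` — the finite orbit average `Φ₁ = [K′:S]⁻¹ Σ_{q ∈ K′∕S} Φ ∘ ρ(q̃)⁻¹` over the open stabiliser `S` of `Φ` (★ (A4-avg)
  `exists_isOpen_subgroup_finite_quotient_leviOp`) is `K′`-invariant (★ `apply_orbitAverage_eq`) and `re ℓ(Φ₁) ≥ [K′:S]⁻¹ re ℓ(Φ) > 0`.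
HONEST LABEL.  `HC_CM` is proved only modulo the 7 printed citations (2 remaining named inputs: hLiu418 = `stmt-HodgeConjecture-24832`,
h413 = `stmt-HodgeConjecture-24833`) until rung 0 closes.

## References
* [BernsteinZelevinsky1976] I. N. Bernstein, A. V. Zelevinsky, Russian Math. Surveys 31 (1976), §2 (smooth vectors, finite orbits under compact open subgroups).
* [MoeglinVignerasWaldspurger1987] C. Mœglin, M.-F. Vignéras, J.-L. Waldspurger, LNM 1291, Chap. 2 II.8.
* [GanQiuTakeda2014] W. T. Gan, Y. Qiu, S. Takeda, Invent. Math. 198 (2014), §2.7–2.8.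
-/

set_option autoImplicit false
set_option linter.dupNamespace false -- the mandated namespace repeats `HodgeConjecture.HodgeConjecture`

noncomputable section

open scoped Classical
open Topology
open Literature.NumberTheory.Automorphic Literature.RepresentationTheory.HeisenbergGroup
open Summit.HodgeConjecture.HodgeConjecture.Cruxes.HLiu418.F0LD1OrbitAverageFixed
open Summit.HodgeConjecture.HodgeConjecture.Cruxes.HLiu418.K2LiuSWSectionKPrimeAverage

namespace Summit.HodgeConjecture.HodgeConjecture.Cruxes.HLiu418.K2LiuA7ValueKPrimeWitness

variable {F : Type*} [Field F] [ValuativeRel F] [TopologicalSpace F] [IsNonarchimedeanLocalField F]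
  {ι : Type*} [Fintype ι] [DecidableEq ι]
  {G : Type*} [Group G] [TopologicalSpace G] [IsTopologicalGroup G]

/-- **A `K′`-INVARIANT VECTOR ON WHICH `ℓ` IS NON-ZERO**, from one `Φ ∈ 𝒮(F^ι)` with `re ℓ(Φ ∘ ρ(k)⁻¹) ≥ 0` for all `k ∈ K′` and `re ℓ(Φ) > 0` (`K′` compact,
`ρ` pointwise continuous): the finite orbit average of `Φ` over its open stabiliser in `K′`. [cite: BernsteinZelevinsky1976, §2] [cite: GanQiuTakeda2014, §2.7–2.8] -/
theorem exists_invariant_apply_ne_zero (K' : Subgroup G) (hK' : IsCompact (K' : Set G)) (ρ : G →* ((ι → F) ≃ₗ[F] (ι → F)))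
    (hρ : ∀ u, Continuous fun g : G => ρ g u) (hc : ∀ g, Continuous (ρ g)) (hc' : ∀ g, Continuous (ρ g).symm)
    (ℓ : SchwartzBruhat (ι → F) →ₗ[ℂ] ℂ) (Φ : SchwartzBruhat (ι → F))
    (hre : ∀ k ∈ K', 0 ≤ (ℓ (leviEquivSB (ρ k) (hc k) (hc' k) Φ)).re) (hpos : 0 < (ℓ Φ).re) :
    ∃ Φ₁ : SchwartzBruhat (ι → F), (∀ k ∈ K', leviOp (ρ k) (Φ₁ : (ι → F) → ℂ) = Φ₁) ∧ ℓ Φ₁ ≠ 0 := by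
  haveI : CompactSpace ↥K' := isCompact_iff_compactSpace.1 hK'
  -- the action of `K′` on `𝒮(F^ι)` as a representation
  let π : Representation ℂ ↥K' (SchwartzBruhat (ι → F)) :=
    { toFun := fun k => (leviEquivSB (ρ (k : G)) (hc _) (hc' _)).toLinearMap
      map_one' := by
        apply LinearMap.ext; intro Ψ; apply Subtype.ext
        rw [LinearEquiv.coe_coe, coe_leviEquivSB, OneMemClass.coe_one, map_one, leviOp_one]; rfl
      map_mul' := fun a b => by
        apply LinearMap.ext; intro Ψ; apply Subtype.ext
        simp only [LinearEquiv.coe_coe, coe_leviEquivSB, Module.End.mul_apply]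
        rw [Subgroup.coe_mul, map_mul, leviOp_mul, LinearEquiv.mul_apply] }
  have hπ : ∀ (k : ↥K') (Ψ : SchwartzBruhat (ι → F)), π k Ψ = leviEquivSB (ρ (k : G)) (hc _) (hc' _) Ψ := fun _ _ => rfl
  -- the open stabiliser of `Φ` in `K′`, of finite index
  obtain ⟨S, -, hSf, hS⟩ := exists_isOpen_subgroup_finite_quotient_leviOp (ρ.comp K'.subtype)
    (fun u => (hρ u).comp continuous_subtype_val) Φ
  letI : Fintype (↥K' ⧸ S) := Fintype.ofFinite _
  have hSπ : ∀ s ∈ S, π s Φ = Φ := fun s hs => Subtype.ext (by rw [hπ, coe_leviEquivSB]; exact (hS s).1 hs)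
  -- the orbit average
  refine ⟨((Fintype.card (↥K' ⧸ S) : ℂ)⁻¹) • ∑ q : ↥K' ⧸ S, π q.out Φ, fun k hk => ?_, ?_⟩
  · have h1 := apply_orbitAverage_eq π S hSπ ((Fintype.card (↥K' ⧸ S) : ℂ)⁻¹) ⟨k, hk⟩
    rw [hπ] at h1
    have h2 := congrArg (fun Ψ : SchwartzBruhat (ι → F) => (Ψ : (ι → F) → ℂ)) h1
    simpa only [coe_leviEquivSB] using h2
  · -- `re ℓ(Φ₁) = [K′:S]⁻¹ Σ_q re ℓ(π q̃ Φ) ≥ [K′:S]⁻¹ re ℓ(Φ) > 0`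
    intro h0
    have hcard : (0 : ℝ) < Fintype.card (↥K' ⧸ S) := by exact_mod_cast Fintype.card_pos_iff.2 ⟨((1 : ↥K') : ↥K' ⧸ S)⟩
    have hsum : (ℓ (∑ q : ↥K' ⧸ S, π q.out Φ)).re = ∑ q : ↥K' ⧸ S, (ℓ (π q.out Φ)).re := by
      rw [map_sum, Complex.re_sum]
    have hq : ∀ q : ↥K' ⧸ S, 0 ≤ (ℓ (π q.out Φ)).re := fun q => by rw [hπ]; exact hre _ q.out.2
    -- the class of `1` contributes `re ℓ(Φ)`
    obtain ⟨s, hs⟩ := QuotientGroup.mk_out_eq_mul S (1 : ↥K')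
    have hone : π ((QuotientGroup.mk (1 : ↥K') : ↥K' ⧸ S).out) Φ = Φ := by
      rw [hs, one_mul, hSπ _ s.2]
    have hge : (ℓ Φ).re ≤ ∑ q : ↥K' ⧸ S, (ℓ (π q.out Φ)).re := by
      have := Finset.single_le_sum (fun q _ => hq q) (Finset.mem_univ (QuotientGroup.mk (1 : ↥K') : ↥K' ⧸ S))
      rwa [hone] at this
    have hre0 : (ℓ (((Fintype.card (↥K' ⧸ S) : ℂ)⁻¹) • ∑ q : ↥K' ⧸ S, π q.out Φ)).re = 0 := by rw [h0, Complex.zero_re]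
    rw [map_smul, smul_eq_mul, Complex.mul_re, hsum, ← Complex.ofReal_natCast, ← Complex.ofReal_inv, Complex.ofReal_re, Complex.ofReal_im,
      zero_mul, sub_zero] at hre0
    have : 0 < ((Fintype.card (↥K' ⧸ S) : ℝ))⁻¹ * ∑ q : ↥K' ⧸ S, (ℓ (π q.out Φ)).re :=
      mul_pos (inv_pos.2 hcard) (lt_of_lt_of_le hpos hge)
    exact this.ne' hre0

end Summit.HodgeConjecture.HodgeConjecture.Cruxes.HLiu418.K2LiuA7ValueKPrimeWitness

end
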